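import Literature.AlgebraicGeometry.AbelianSchemes.SerreCoverTransportAlongIso
import Literature.AlgebraicGeometry.AbelianSchemes.HeckeLinesTransportAlongIso
import Literature.AlgebraicGeometry.AbelianSchemes.TupleIsoViaPointExactIso
import Summits.HodgeConjecture.HodgeConjecture.Theorems.F0P6aStubKOTT
import HarnessLib
import HarnessLib.Audit.LibrarySuggestionsDenyListCruxes

/-!
# `F0P6aEReadings` — ★ VERBATIM TWIN (K6 P∕E column wave E1, LEAD F0P6-plan «M-142a» (B); RE-HOME TABLE v1.7 (LA7-plan (g7)), canonical header «M-142a» (A), carrier «M-142d» «P-κ») of the E-READINGS module `Lines/F0_P6a_EReadings.lean` ED. 2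

**SIZE-LINT SPLIT ×3** (`Theorems/` files with proofs are ≤ 400 lines): parts `Theorems/F0P6aEReadingsDefs.lean` → `Theorems/F0P6aEReadingsHecke.lean` → `Theorems/F0P6aEReadings.lean`, each importing the previous, cut at declaration boundaries of `Lines/F0_P6a_EReadings.lean`; namespaces AND sections KEPT and re-opened per part (with their `open`∕`variable` lines replayed verbatim); the options preamble is repeated. This is PART 1.

This `Theorems/` module is the TREE BYTES of `Summits/HodgeConjecture/HodgeConjecture/Cruxes/HLiu418/Lines/F0_P6a_EReadings.lean` (tree sha16 18b1390e9a57b55f, 961 l.; sorry-free, stub-free = class B of RE-HOME TABLE v1.7)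
re-homed VERBATIM with the NAMESPACE KEPT (`Summit.HodgeConjecture.HodgeConjecture.Cruxes.HLiu418.F0P6aEReadings`), so every fully-qualified name of its 27 declarations is UNCHANGED
(0 FQN moves, 0 downstream bytes, 0 statement bytes).  The only edits are (a) this re-headed module docstring, (b) the `Lines` imports switched to their ★ homes (l.4 `Lines.F0_P6a_StubKOTT` → `Theorems.F0P6aStubKOTT`),
and (c) on the docstrings of the header-CLOSED `def … : Prop` letters (`RecordHeckeTransport`, `RecordCoverTransport`, `RecordCoverKerTransport`) the locator tokens are spelled `(print: …)` instead of `[cite: …]` — same locators, same prose — because a `[cite:]`-tagged closed Prop in a `Theorems/` proposal is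
RELOCATED to `Literature/` by the gate («STATE IT INLINE» rule; observed p852785∕p852786, LA-ref1 (g5) BOX K5 #R1), which would MOVE the FQN; these Props are statement
ABBREVIATIONS of our own sockets, not printed facts (precedent ★ `Theorems/F0P6aModuliDatumDefs.lean` `RecordModuliDatumCofinal` `(print:)` ×5).

Why: after (K5-R) the reverse cone of the spine still holds the E-column (`EReadings` → `CoverEOfComplex` ∕ `StubEHECKE` ∕ `StubESHEET` → `EExports` → `StubGEN` …); every one of
them must be re-homed under `Theorems/` before the MAIN ★ twin can exist (a `Theorems/` file cannot import a `Lines/` workfile — gate import fence).  This module՚s only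
`Lines` import (`F0_P6a_StubKOTT`) has its ★ twin LANDED (K5 №2), so it is the first fileable E-column parent (parents-first).  After its LAST part is ★ the `Lines`
original becomes ED. 3 = SHIM (`import` of this module + `HarnessLib` + carrier; 0 declarations), written on the LEAD՚s cue in a K6 shim wave after (K5-R) BUILT.
HC_CM is proved only modulo the 7 printed citations (2 remaining: hLiu418 = stmt-HodgeConjecture-24832, h413 = stmt-HodgeConjecture-24833) until rung 0 closes; a re-home is count-neutral.

## Import provenance (header is CANONICAL: bare `import` lines, «M-142a» (A); the ROOT part carries `HarnessLib.Audit.LibrarySuggestionsDenyListCruxes`, «M-142d» «P-κ»)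
- `Literature.AlgebraicGeometry.AbelianSchemes.SerreCoverTransportAlongIso` — ★ p847952 per-point core `cover_transport_along_iso` (LA4-p01)
- `Literature.AlgebraicGeometry.AbelianSchemes.HeckeLinesTransportAlongIso` — ★ p848473 Hecke lines (a)(b)(c) along a MulEquiv of points (LA4-p01); re-exports ★ p847813 `roof_transport_along_iso`
- `Literature.AlgebraicGeometry.AbelianSchemes.TupleIsoViaPointExactIso` — ★ p848009 the `(G, Ĝ) ⇒ e` bridge (LA4-p01)
- `Summits.HodgeConjecture.HodgeConjecture.Theorems.F0P6aStubKOTT` — ★ K5 №2 p852867 (№1 `…F0P6aStubKOTTRows` p852853 rides): the KOTT leaf twin; the `Lines` module is its ED. 3 shim since 23:12Z (commit a766626da282)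
- `HarnessLib`

## Original module docstring (verbatim)
# F0 ∕ P6a — `Cruxes/HLiu418/Lines/F0_P6a_EReadings.lean`: THE E-CURRENCY READINGS `EHeckeAt` ∕ `ETwistAt` AND THE BY-VALUE TRANSPORT ORGAN HEADS (L4, LEAD «M-55» (c); desk R5)

WHY (desk F0P6a-plan (g4) JUNK FINDING 02:04:50Z, n5 one level down; LA4-plan (g0) DEAL v1 02:01:43Z): the laws `PELHeckeLawAt T` ∕ `PELTwistLawAt T` of a
BY-VALUE spread `T : PELSpreadAt …` (P-line ED. 1) cannot be socketed as «∀ T, law T» — FALSE for junk witnesses `T.E` — and the honest transport form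
«∀ T, (E-side law of T.E) → (law of T)» needs E-CURRENCY READINGS of the Hecke roofs and of the Serre covers: the bodies of Defs `RoofΩ` ∕ `CoverΩ` and of the
spine՚s `HeckeRoofsΩ` read NOT on the generic fibre `ι_η ∘ ℓ_e y` of a tuple over `𝓨 = (𝓜.localise w).total` but DIRECTLY on a tuple over the thickened record
curve `X = (S.M Kc) ⊗_F Fᵢ` at the sheet point `ℓ_e y = thickeningLift e (S.M Kc) y` — NO integral model `𝓜` anywhere.  This file types them, TOKEN FOR TOKEN
under the substitution `(𝒜.baseChange ι_η).baseChange ℓ ↦ 𝒜.baseChange ℓ`, `fibreHom (baseChangeHom (ρ.i a) ι_η) ℓ ↦ fibreHom (ρ.i a) ℓ`: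
§0 the point readings `schEOf` ∕ `fibreEOf` ∕ `dualEOf` ∕ `polEOf` ∕ `lvlPtEOf` ∕ `actEOf` ∕ `IsIdealTorsionE` (twins of Defs :275–:345);
§1 `RoofE` ∕ `CoverE` ∕ `HeckeRoofsE` (twins of Defs `RoofΩ` :361, `CoverΩ` :409, spine `HeckeRoofsΩ` :83);
§2 the two LETTERS keyed by an E-witness: `EHeckeAt S hU7ₛ hJ hJu Kc w hw E pChar fDeg` and `ETwistAt S Kc w e E pChar fDeg` (the twist rows (a)(b)(c)(FROB-𝔞)(FROB-n)
of `PELTwistLawAt` VERBATIM with `T.E.N ↦ E.N`, `T.pChar ^ T.fDeg ↦ pChar ^ fDeg`, and `CoverE` for `CoverΩ`);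
§3 the two TRANSPORT SOCKETS `stub_HECKETRANS : RecordHeckeTransport` ∕ `stub_COVERTRANS : RecordCoverTransport` (letters BY VALUE, TRUE for every pair of tuples
related by a `gen_iso` — binders of the KOTT leaf՚s ★ `kottwitzΩ_of_gen_iso` VERBATIM, `ι_η` inlined by `letI`; bodies `sorry`, LEAD heir (g3) 02:14:48Z (B) token ask)
and their sorry-free CONSUMERS `heckeRoofsΩ_of_gen_iso : … → HeckeRoofsE … → HeckeRoofsΩ …`, `coverΩ_of_gen_iso : … → CoverE … → CoverΩ …` (what the leaf
`Lines/F0_P6a_PELSpread.lean` ED. 2 instantiates as `stub_HECKE` ∕ `stub_TWIST`).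
NOTHING here is asserted except inside the two `sorry` sockets; every `def` is a `Prop` or a reading.  HOME-first candidate (LA4-plan (g0)); tree write only on a LEAD «M-n» word.
HONEST LABEL: HC_CM is proved only modulo the 7 printed citations (2 remaining: hLiu418 = stmt-HodgeConjecture-24832, h413 = stmt-HodgeConjecture-24833) until rung 0 closes.
[cite: Kottwitz1992, §5 pp. 389–391] [cite: RapoportSmithlingZhang2020Diagonal, §4.1 p. 17, §4.3 (4.23) p. 21] [cite: MumfordFogartyKirwan1994, Ch. 7 §2 Definition 7.1 (p. 129)]
-/

set_option autoImplicit false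

noncomputable section


namespace Summit.HodgeConjecture.HodgeConjecture.Cruxes.HLiu418.F0P6aEReadings

set_option linter.dupNamespace false  -- `Summit.HodgeConjecture.HodgeConjecture.…` BY DESIGN (D-0017)

open CategoryTheory CategoryTheory.Limits NumberField IsDedekindDomain MulAction
open scoped Matrix Polynomial Pointwise
open Literature.NumberTheory.GaloisRepresentations
open Literature.NumberTheory.Automorphic Literature.NumberTheory.Automorphic.UnitaryGroup
open Literature.AlgebraicGeometry.ShimuraVarieties.UnitaryCanonicalModel
open Literature.NumberTheory.Automorphic.Liu2021.AppendixC
open Literature.AlgebraicGeometry.Motives (AlgPoints ComplexPoints IntegralModel SchemeOver thickening thickeningGalAction thickeningLift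
  thickeningπ baseChange specOver)
open Literature.AlgebraicGeometry.AbelianSchemes (AbelianSchemeOver)
open Literature.AlgebraicGeometry.AbelianSchemes.AbelianSchemeOver (fibreHom RingAction)
open Literature.NumberTheory.DiophantineGeometry (geomResidueField specialFibreFunctor)
open Literature.AlgebraicGeometry.RelativeSpec (ActionOver)
open Literature.NumberTheory.EllipticCurves (genericFibre)
open Summit.HodgeConjecture.HodgeConjecture.Cruxes.HLiu418.F0P6aModuliDatumDefs
open Summit.HodgeConjecture.HodgeConjecture.Cruxes.HLiu418.F0P6aRGDAssembly
open Summit.HodgeConjecture.HodgeConjecture.Cruxes.HLiu418.F0P6aPELWitnessE (PELWitnessE IsCMTypeThrough)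
open Summit.HodgeConjecture.HodgeConjecture.Cruxes.HLiu418.F0P6aIsomSchemeFiniteType (TupleIsoAt₂)

/-! ### §0 The E-side point readings over `X = (S.M Kc) ⊗_F Fᵢ` at the sheet point `ℓ_e y` (twins of Defs §1‴, NO `𝓜`) -/

/-- (E-ii-3) the E-tuple՚s abelian SCHEME over `Spec Ω` at the sheet point `ℓ_e y` — ONE base change `𝒜 ×_X Spec Ω` along `thickeningLift e (S.M.obj Kc) y` (twin of Defs
`schΩOf`, whose iterated base change along `ι_η` then `ℓ_e y` it replaces); `fibreEOf … 𝒜 y = (schEOf … 𝒜 y).toAffine.toAbelianVariety` ON THE NOSE (★ `fibre`).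
[cite: MumfordFogartyKirwan1994, Ch. 6 §1 (p. 115)] -/
abbrev schEOf {F : Type} [Field F] [NumberField F] [IsCMField F] {ι₁ : F →+* ℂ} {Jstar : Matrix (Fin 2) (Fin 2) F}
    {K₀ : C5.OpenCompactSubgroup ↥(finAdelic ↥(maximalRealSubfield F) F (IsCMField.complexConj F) 2 Jstar)}
    (S : RecordSystemGS F Jstar ι₁ K₀) {Fi : Type} [Field Fi] [Algebra F Fi] (Kc : C5.SmallLevel K₀)
    (w : HeightOneSpectrum (𝓞 F))
    (e : Fi →ₐ[F] AlgebraicClosure (w.adicCompletion F))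
    (𝒜 : Literature.AlgebraicGeometry.AbelianSchemes.AbelianSchemeOver ((Literature.AlgebraicGeometry.Motives.baseChange F Fi).obj (S.M.obj Kc)).left)
    (y : AlgPoints (S.M.obj Kc) (AlgebraicClosure (w.adicCompletion F))) :
    Literature.AlgebraicGeometry.AbelianSchemes.AbelianSchemeOver (AlgebraicGeometry.Spec (CommRingCat.of (AlgebraicClosure (w.adicCompletion F)))) :=
  𝒜.baseChange (thickeningLift e (S.M.obj Kc) y).left

/-- (E-ii-1) the abelian variety over `Ω = F̄_w` underlying the fibre of the E-tuple at the sheet point `ℓ_e y` (★ `fibre`; twin of Defs `fibreΩOf`; the (K-Ω) currency of the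
E-line՚s `kottwitz` field read at `Ω`-points). [cite: MumfordFogartyKirwan1994, Ch. 6 §1 (p. 115)] -/
abbrev fibreEOf {F : Type} [Field F] [NumberField F] [IsCMField F] {ι₁ : F →+* ℂ} {Jstar : Matrix (Fin 2) (Fin 2) F}
    {K₀ : C5.OpenCompactSubgroup ↥(finAdelic ↥(maximalRealSubfield F) F (IsCMField.complexConj F) 2 Jstar)}
    (S : RecordSystemGS F Jstar ι₁ K₀) {Fi : Type} [Field Fi] [Algebra F Fi] (Kc : C5.SmallLevel K₀)
    (w : HeightOneSpectrum (𝓞 F))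
    (e : Fi →ₐ[F] AlgebraicClosure (w.adicCompletion F))
    (𝒜 : Literature.AlgebraicGeometry.AbelianSchemes.AbelianSchemeOver ((Literature.AlgebraicGeometry.Motives.baseChange F Fi).obj (S.M.obj Kc)).left)
    (y : AlgPoints (S.M.obj Kc) (AlgebraicClosure (w.adicCompletion F))) :
    Literature.AlgebraicGeometry.Motives.AbelianVariety (AlgebraicClosure (w.adicCompletion F)) :=
  (𝒜.fibre (thickeningLift e (S.M.obj Kc) y).left).toAbelianVariety

/-- (E-ii-3) the dual pair `(Â, 𝒫)` of the E-tuple read at `ℓ_e y` (★ `DualPair.baseChange`, once; twin of Defs `dualΩOf`). [cite: MumfordFogartyKirwan1994, Ch. 6 §1 (p. 115)] -/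
abbrev dualEOf {F : Type} [Field F] [NumberField F] [IsCMField F] {ι₁ : F →+* ℂ} {Jstar : Matrix (Fin 2) (Fin 2) F}
    {K₀ : C5.OpenCompactSubgroup ↥(finAdelic ↥(maximalRealSubfield F) F (IsCMField.complexConj F) 2 Jstar)}
    (S : RecordSystemGS F Jstar ι₁ K₀) {Fi : Type} [Field Fi] [Algebra F Fi] (Kc : C5.SmallLevel K₀)
    (w : HeightOneSpectrum (𝓞 F))
    (e : Fi →ₐ[F] AlgebraicClosure (w.adicCompletion F))
    (𝒜 : Literature.AlgebraicGeometry.AbelianSchemes.AbelianSchemeOver ((Literature.AlgebraicGeometry.Motives.baseChange F Fi).obj (S.M.obj Kc)).left)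
    (D : 𝒜.DualPair) (y : AlgPoints (S.M.obj Kc) (AlgebraicClosure (w.adicCompletion F))) : (schEOf S Kc w e 𝒜 y).DualPair :=
  D.baseChange (thickeningLift e (S.M.obj Kc) y).left

/-- (E-ii-3) the polarisation `λ` of the E-tuple read at `ℓ_e y` (★ `Polarization.baseChange`, once; EXACT, no scalar; twin of Defs `polΩOf`).
[cite: MumfordFogartyKirwan1994, Ch. 6 §2 Definition 6.3 (p. 120)] -/
abbrev polEOf {F : Type} [Field F] [NumberField F] [IsCMField F] {ι₁ : F →+* ℂ} {Jstar : Matrix (Fin 2) (Fin 2) F}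
    {K₀ : C5.OpenCompactSubgroup ↥(finAdelic ↥(maximalRealSubfield F) F (IsCMField.complexConj F) 2 Jstar)}
    (S : RecordSystemGS F Jstar ι₁ K₀) {Fi : Type} [Field Fi] [Algebra F Fi] (Kc : C5.SmallLevel K₀)
    (w : HeightOneSpectrum (𝓞 F))
    (e : Fi →ₐ[F] AlgebraicClosure (w.adicCompletion F))
    (𝒜 : Literature.AlgebraicGeometry.AbelianSchemes.AbelianSchemeOver ((Literature.AlgebraicGeometry.Motives.baseChange F Fi).obj (S.M.obj Kc)).left)
    {D : 𝒜.DualPair} (pol : 𝒜.Polarization D) (y : AlgPoints (S.M.obj Kc) (AlgebraicClosure (w.adicCompletion F))) :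
    (schEOf S Kc w e 𝒜 y).Polarization (dualEOf S Kc w e 𝒜 D y) :=
  pol.baseChange (thickeningLift e (S.M.obj Kc) y).left

/-- (E-ii-3) the level point `σ^a(ℓ_e y) ∈ A_{ℓ_e y}(Ω)` of a level-`N` structure on the E-tuple (★ `section_`, ★ `restrictPt`; twin of Defs `lvlPtΩOf`).
[cite: MumfordFogartyKirwan1994, Ch. 7 §2 Definition 7.1 (p. 129)] -/
def lvlPtEOf {F : Type} [Field F] [NumberField F] [IsCMField F] {ι₁ : F →+* ℂ} {Jstar : Matrix (Fin 2) (Fin 2) F}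
    {K₀ : C5.OpenCompactSubgroup ↥(finAdelic ↥(maximalRealSubfield F) F (IsCMField.complexConj F) 2 Jstar)}
    (S : RecordSystemGS F Jstar ι₁ K₀) {Fi : Type} [Field Fi] [Algebra F Fi] (Kc : C5.SmallLevel K₀)
    (w : HeightOneSpectrum (𝓞 F))
    (e : Fi →ₐ[F] AlgebraicClosure (w.adicCompletion F))
    (𝒜 : Literature.AlgebraicGeometry.AbelianSchemes.AbelianSchemeOver ((Literature.AlgebraicGeometry.Motives.baseChange F Fi).obj (S.M.obj Kc)).left)
    {g N : ℕ} (lvl : 𝒜.LevelStructure g N) (y : AlgPoints (S.M.obj Kc) (AlgebraicClosure (w.adicCompletion F))) (a : Fin g ⊕ Fin g → ZMod N) :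
    (fibreEOf S Kc w e 𝒜 y).Points (AlgebraicClosure (w.adicCompletion F)) :=
  𝒜.restrictPt (thickeningLift e (S.M.obj Kc) y).left (lvl.section_ a)

/-- (E-ii-1) the endomorphism `ι(a)` of the fibre of the E-tuple at `ℓ_e y` induced by a ring action `ρ` of `𝒪_F` (★ `fibreHom (ρ.i a)`; twin of Defs `actΩOf`; the
E-line՚s `kottwitz`-field currency). [cite: Kottwitz1992, §5, p. 390] -/
def actEOf {F : Type} [Field F] [NumberField F] [IsCMField F] {ι₁ : F →+* ℂ} {Jstar : Matrix (Fin 2) (Fin 2) F}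
    {K₀ : C5.OpenCompactSubgroup ↥(finAdelic ↥(maximalRealSubfield F) F (IsCMField.complexConj F) 2 Jstar)}
    (S : RecordSystemGS F Jstar ι₁ K₀) {Fi : Type} [Field Fi] [Algebra F Fi] (Kc : C5.SmallLevel K₀)
    (w : HeightOneSpectrum (𝓞 F))
    (e : Fi →ₐ[F] AlgebraicClosure (w.adicCompletion F))
    (𝒜 : Literature.AlgebraicGeometry.AbelianSchemes.AbelianSchemeOver ((Literature.AlgebraicGeometry.Motives.baseChange F Fi).obj (S.M.obj Kc)).left)
    (ρ : Literature.AlgebraicGeometry.AbelianSchemes.AbelianSchemeOver.RingAction (𝓞 F) 𝒜) (a : 𝓞 F)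
    (y : AlgPoints (S.M.obj Kc) (AlgebraicClosure (w.adicCompletion F))) :
    fibreEOf S Kc w e 𝒜 y ⟶ fibreEOf S Kc w e 𝒜 y :=
  haveI := ρ.isMonHom a
  Literature.AlgebraicGeometry.AbelianSchemes.AbelianSchemeOver.fibreHom (ρ.i a) (thickeningLift e (S.M.obj Kc) y).left

/-- (E-ii-3) the `Ω`-point `P` of the fibre of the E-tuple at `ℓ_e y` is KILLED BY THE IDEAL `𝔞 ⊆ 𝒪_F` (twin of Defs `IsIdealTorsionΩ`). [cite: Kottwitz1992, §5, p. 390] -/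
def IsIdealTorsionE {F : Type} [Field F] [NumberField F] [IsCMField F] {ι₁ : F →+* ℂ} {Jstar : Matrix (Fin 2) (Fin 2) F}
    {K₀ : C5.OpenCompactSubgroup ↥(finAdelic ↥(maximalRealSubfield F) F (IsCMField.complexConj F) 2 Jstar)}
    (S : RecordSystemGS F Jstar ι₁ K₀) {Fi : Type} [Field Fi] [Algebra F Fi] (Kc : C5.SmallLevel K₀)
    (w : HeightOneSpectrum (𝓞 F))
    (e : Fi →ₐ[F] AlgebraicClosure (w.adicCompletion F))
    (𝒜 : Literature.AlgebraicGeometry.AbelianSchemes.AbelianSchemeOver ((Literature.AlgebraicGeometry.Motives.baseChange F Fi).obj (S.M.obj Kc)).left)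
    (ρ : Literature.AlgebraicGeometry.AbelianSchemes.AbelianSchemeOver.RingAction (𝓞 F) 𝒜)
    (y : AlgPoints (S.M.obj Kc) (AlgebraicClosure (w.adicCompletion F))) (𝔞 : Ideal (𝓞 F))
    (P : (fibreEOf S Kc w e 𝒜 y).Points (AlgebraicClosure (w.adicCompletion F))) : Prop :=
  ∀ a ∈ 𝔞, (AlgPoints.map (actEOf S Kc w e 𝒜 ρ a y).hom.hom.hom P : (fibreEOf S Kc w e 𝒜 y).Points (AlgebraicClosure (w.adicCompletion F))) = 1

/-! ### §1 The E-side roof, cover and Hecke-roofs readings (bodies of Defs `RoofΩ` ∕ `CoverΩ` and spine `HeckeRoofsΩ` TOKEN FOR TOKEN, `𝓜`-free) -/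

set_option maxHeartbeats 400000 in
/-- (E-ii-4) **THE ISOGENY ROOF `A_{ℓ_e y} —q→ B ←c— A_{ℓ_e y″}` ON THE E-SIDE** — Defs `RoofΩ` ((r1)–(r5), J12 unit pin included) read on the E-tuple over `X` at the sheet
points `ℓ_e y`, `ℓ_e y″` (substitution of the module docstring).  NOT asserted by declaring it.
[cite: MumfordAV1970, §23 Thm. 2 p. 231; §15 Thm. 1 p. 143] [cite: RapoportSmithlingZhang2020Diagonal, §4.1 p. 17, §4.3 (4.23) p. 21] [cite: Kottwitz1992, §5, p. 391] -/
def RoofE {F : Type} [Field F] [NumberField F] [IsCMField F] {ι₁ : F →+* ℂ} {Jstar : Matrix (Fin 2) (Fin 2) F}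
    {K₀ : C5.OpenCompactSubgroup ↥(finAdelic ↥(maximalRealSubfield F) F (IsCMField.complexConj F) 2 Jstar)}
    (S : RecordSystemGS F Jstar ι₁ K₀) {Fi : Type} [Field Fi] [Algebra F Fi] (Kc : C5.SmallLevel K₀)
    (w : HeightOneSpectrum (𝓞 F))
    (e : Fi →ₐ[F] AlgebraicClosure (w.adicCompletion F))
    (𝒜 : Literature.AlgebraicGeometry.AbelianSchemes.AbelianSchemeOver ((Literature.AlgebraicGeometry.Motives.baseChange F Fi).obj (S.M.obj Kc)).left)
    (ρ : Literature.AlgebraicGeometry.AbelianSchemes.AbelianSchemeOver.RingAction (𝓞 F) 𝒜)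
    (D : 𝒜.DualPair) (pol : 𝒜.Polarization D) {g N : ℕ} (lvl : 𝒜.LevelStructure g N) (pChar : ℕ) (𝔞 : Ideal (𝓞 F))
    (y y'' : AlgPoints (S.M.obj Kc) (AlgebraicClosure (w.adicCompletion F)))
    (K : Subgroup ((fibreEOf S Kc w e 𝒜 y).Points (AlgebraicClosure (w.adicCompletion F)))) : Prop :=
  ∃ (B : Literature.AlgebraicGeometry.AbelianSchemes.AbelianSchemeOver (AlgebraicGeometry.Spec (CommRingCat.of (AlgebraicClosure (w.adicCompletion F)))))
    (DB : B.DualPair) (lamB : B.X ⟶ DB.hat.X) (_ : IsMonHom lamB)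
    -- J12 INTERFACE PIN (ref1 (g2) e-12): `B̂`'s Poincaré sheaf is normalised along `A × {ε_B̂}` — the unit clause `hD_B` (for a ★ `Polarization` it is ★ `Polarization.nonempty_unitHatSlice_iso`)
    (_ : Nonempty ((AlgebraicGeometry.Scheme.Modules.pullback DB.unitHatSlice).obj DB.P ≅ SheafOfModules.unit _))
    (q : (schEOf S Kc w e 𝒜 y).X ⟶ B.X) (_ : IsMonHom q)
    (c : (schEOf S Kc w e 𝒜 y'').X ⟶ B.X) (_ : IsMonHom c),
    -- (r1) kernel of `q` on `Ω`-points
    (∀ P : (fibreEOf S Kc w e 𝒜 y).Points (AlgebraicClosure (w.adicCompletion F)),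
        (AlgPoints.map q P : B.toAffine.toAbelianVariety.Points (AlgebraicClosure (w.adicCompletion F))) = 1 ↔ P ∈ K) ∧
    -- (r2) kernel of `c` on `Ω`-points = the `𝔞`-torsion; `c` surjective
    (∀ P : (fibreEOf S Kc w e 𝒜 y'').Points (AlgebraicClosure (w.adicCompletion F)),
        (AlgPoints.map c P : B.toAffine.toAbelianVariety.Points (AlgebraicClosure (w.adicCompletion F))) = 1 ↔
          IsIdealTorsionE S Kc w e 𝒜 ρ y'' 𝔞 P) ∧
    Function.Surjective c.left.base ∧
    -- (r3) polarisations: `q^* λ_B = p • λ_y`, `c^* λ_B = p • λ_y″`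
    q ≫ lamB ≫ Literature.AlgebraicGeometry.AbelianSchemes.AbelianSchemeOver.DualPair.dualIsogenyOver q (dualEOf S Kc w e 𝒜 D y) DB =
      (polEOf S Kc w e 𝒜 pol y).lam ≫ (dualEOf S Kc w e 𝒜 D y).hat.mulN pChar ∧
    c ≫ lamB ≫ Literature.AlgebraicGeometry.AbelianSchemes.AbelianSchemeOver.DualPair.dualIsogenyOver c (dualEOf S Kc w e 𝒜 D y'') DB =
      (polEOf S Kc w e 𝒜 pol y'').lam ≫ (dualEOf S Kc w e 𝒜 D y'').hat.mulN pChar ∧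
    -- (r4) `𝒪_F`-equivariance through a common endomorphism of `B`
    (∀ a : 𝓞 F, ∃ b : B.X ⟶ B.X,
        (actEOf S Kc w e 𝒜 ρ a y).hom.hom.hom ≫ q = q ≫ b ∧ (actEOf S Kc w e 𝒜 ρ a y'').hom.hom.hom ≫ c = c ≫ b) ∧
    -- (r5) level-`N` points correspond
    (∀ a : Fin g ⊕ Fin g → ZMod N,
        (AlgPoints.map q (lvlPtEOf S Kc w e 𝒜 lvl y a) : B.toAffine.toAbelianVariety.Points (AlgebraicClosure (w.adicCompletion F))) =
          AlgPoints.map c (lvlPtEOf S Kc w e 𝒜 lvl y'' a))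

set_option maxHeartbeats 400000 in
/-- (E-ii-5) **THE SERRE COVER `c : A_{ℓ_e y} → A_{ℓ_{e′} y}` BETWEEN TWO SHEETS ON THE E-SIDE** — Defs `CoverΩ` ((t1)–(t5)) read on the E-tuple over `X` (substitution of the
module docstring).  NOT asserted by declaring it. [cite: Shimura1998, §13.1, Theorem 1; §18.6] [cite: Conrad2004GrossZagier, §7, Thm. 7.6]
[cite: RapoportSmithlingZhang2020Diagonal, §3.2 p. 11, §4.3 p. 20] -/
def CoverE {F : Type} [Field F] [NumberField F] [IsCMField F] {ι₁ : F →+* ℂ} {Jstar : Matrix (Fin 2) (Fin 2) F}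
    {K₀ : C5.OpenCompactSubgroup ↥(finAdelic ↥(maximalRealSubfield F) F (IsCMField.complexConj F) 2 Jstar)}
    (S : RecordSystemGS F Jstar ι₁ K₀) {Fi : Type} [Field Fi] [Algebra F Fi] (Kc : C5.SmallLevel K₀)
    (w : HeightOneSpectrum (𝓞 F))
    (e : Fi →ₐ[F] AlgebraicClosure (w.adicCompletion F))
    (𝒜 : Literature.AlgebraicGeometry.AbelianSchemes.AbelianSchemeOver ((Literature.AlgebraicGeometry.Motives.baseChange F Fi).obj (S.M.obj Kc)).left)
    (ρ : Literature.AlgebraicGeometry.AbelianSchemes.AbelianSchemeOver.RingAction (𝓞 F) 𝒜)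
    (D : 𝒜.DualPair) (pol : 𝒜.Polarization D) {g N : ℕ} (lvl : 𝒜.LevelStructure g N)
    (e' : Fi →ₐ[F] AlgebraicClosure (w.adicCompletion F)) (𝔞 : Ideal (𝓞 F)) (n : ℕ)
    (y : AlgPoints (S.M.obj Kc) (AlgebraicClosure (w.adicCompletion F))) : Prop :=
  ∃ (c : (schEOf S Kc w e 𝒜 y).X ⟶ (schEOf S Kc w e' 𝒜 y).X) (_ : IsMonHom c),
    -- (t1) Serre presentation of `𝔞`
    (∀ a ∈ 𝔞, ∃ d : (schEOf S Kc w e' 𝒜 y).X ⟶ (schEOf S Kc w e 𝒜 y).X,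
        c ≫ d = (actEOf S Kc w e 𝒜 ρ a y).hom.hom.hom ∧ d ≫ c = (actEOf S Kc w e' 𝒜 ρ a y).hom.hom.hom) ∧
    -- (t2) upper bound through `𝔞̄` and `(n) = 𝔞𝔞̄`
    (∀ b ∈ (IsCMField.complexConj F) • 𝔞, ∃ f : (schEOf S Kc w e 𝒜 y).X ⟶ (schEOf S Kc w e' 𝒜 y).X,
        c ≫ (actEOf S Kc w e' 𝒜 ρ b y).hom.hom.hom = f ≫ (actEOf S Kc w e' 𝒜 ρ (n : 𝓞 F) y).hom.hom.hom) ∧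
    -- (t3) polarisations: `c^* λ_{e',y} = n • λ_{e,y}`
    c ≫ (polEOf S Kc w e' 𝒜 pol y).lam ≫
        Literature.AlgebraicGeometry.AbelianSchemes.AbelianSchemeOver.DualPair.dualIsogenyOver c
          (dualEOf S Kc w e 𝒜 D y) (dualEOf S Kc w e' 𝒜 D y) =
      (polEOf S Kc w e 𝒜 pol y).lam ≫ (dualEOf S Kc w e 𝒜 D y).hat.mulN n ∧
    -- (t4) `𝒪_F`-equivariance
    (∀ a : 𝓞 F, (actEOf S Kc w e 𝒜 ρ a y).hom.hom.hom ≫ c = c ≫ (actEOf S Kc w e' 𝒜 ρ a y).hom.hom.hom) ∧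
    -- (t5) level-`N` points
    (∀ a : Fin g ⊕ Fin g → ZMod N,
        (AlgPoints.map c (lvlPtEOf S Kc w e 𝒜 lvl y a) :
            (fibreEOf S Kc w e' 𝒜 y).Points (AlgebraicClosure (w.adicCompletion F))) = lvlPtEOf S Kc w e' 𝒜 lvl y a)

/-- (E-L4) **THE E-SIDE HECKE ROOFS `HeckeRoofsE`** — the spine՚s `HeckeRoofsΩ` (binders `e′ N′ hN′Kc rc₁ _hrc₁ hrcN₁ rc₂ _hrc₂ hrcN₂ x′` VERBATIM) read on the E-tuple over `X`
at the sheet points `ℓ_{e′}(u x′)` (substitution of the module docstring): the (U4) reading «Hecke translate at `w` = isogeny roof» as a property of the E-WITNESS, which the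
E-line exports and `heckeRoofsΩ_of_gen_iso` (§3) transports to every spread.  NOT asserted by declaring it. [cite: HarrisTaylorAMS2001, §III.4, pp. 108–110]
[cite: RapoportSmithlingZhang2020Diagonal, §4.1 p. 17, §4.3 (4.23) p. 21] [cite: Liu2021, Lemma C.18 p. 115, Prop. D.8 p. 135] -/
def HeckeRoofsE {F : Type} [Field F] [NumberField F] [IsCMField F] {ι₁ : F →+* ℂ} {Jstar : Matrix (Fin 2) (Fin 2) F}
    {K₀ : C5.OpenCompactSubgroup ↥(finAdelic ↥(maximalRealSubfield F) F (IsCMField.complexConj F) 2 Jstar)}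
    (S : RecordSystemGS F Jstar ι₁ K₀) (hU7ₛ : S.HeckeTranslateDefinedOver)
    (hJ : (Jstar.map (IsCMField.complexConj F))ᵀ = Jstar) (hJu : IsUnit Jstar)
    {Fi : Type} [Field Fi] [Algebra F Fi] (Kc : C5.SmallLevel K₀)
    (w : HeightOneSpectrum (𝓞 F)) (hw : (IsCMField.complexConj F) • w ≠ w)
    (univ : Literature.AlgebraicGeometry.AbelianSchemes.AbelianSchemeOver ((Literature.AlgebraicGeometry.Motives.baseChange F Fi).obj (S.M.obj Kc)).left)
    (act : Literature.AlgebraicGeometry.AbelianSchemes.AbelianSchemeOver.RingAction (𝓞 F) univ)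
    (dual : univ.DualPair) (pol : univ.Polarization dual) {g N : ℕ} (lvl : univ.LevelStructure g N) (pChar fDeg : ℕ) : Prop :=
  ∀ (e' : Fi →ₐ[F] AlgebraicClosure (w.adicCompletion F)) (N' : C5.SmallLevel K₀) (hN'Kc : N' ≤ Kc)
    (rc₁ : orbit (Kc.1.1 : Subgroup ↥(finAdelic ↥(maximalRealSubfield F) F (IsCMField.complexConj F) 2 Jstar))
         ((UnitaryGroup.heckeElementAt ↥(maximalRealSubfield F) F (IsCMField.complexConj F) 2 Jstar
             (⟨w, rfl⟩ : UnitaryGroup.PlacesOver F (w.under (𝓞 ↥(maximalRealSubfield F))))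
             (IsCMField.complexConj_ne_one F) hJ hw (UnitaryGroup.isUnit_placeForm Jstar hJu w) (HeckeCharacter.uniformizer F w) 1 :
           ↥(finAdelic ↥(maximalRealSubfield F) F (IsCMField.complexConj F) 2 Jstar)) :
           ↥(finAdelic ↥(maximalRealSubfield F) F (IsCMField.complexConj F) 2 Jstar) ⧸
             (Kc.1.1 : Subgroup ↥(finAdelic ↥(maximalRealSubfield F) F (IsCMField.complexConj F) 2 Jstar))) →
       ↥(finAdelic ↥(maximalRealSubfield F) F (IsCMField.complexConj F) 2 Jstar))
    (_hrc₁ : ∀ β, ((rc₁ β : ↥(finAdelic ↥(maximalRealSubfield F) F (IsCMField.complexConj F) 2 Jstar)) :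
        ↥(finAdelic ↥(maximalRealSubfield F) F (IsCMField.complexConj F) 2 Jstar) ⧸
          (Kc.1.1 : Subgroup ↥(finAdelic ↥(maximalRealSubfield F) F (IsCMField.complexConj F) 2 Jstar))) = β.1)
    (hrcN₁ : ∀ β, C5.HeckeLE (rc₁ β) N' Kc)
    (rc₂ : orbit (Kc.1.1 : Subgroup ↥(finAdelic ↥(maximalRealSubfield F) F (IsCMField.complexConj F) 2 Jstar))
         ((UnitaryGroup.heckeElementAt ↥(maximalRealSubfield F) F (IsCMField.complexConj F) 2 Jstar
             (⟨w, rfl⟩ : UnitaryGroup.PlacesOver F (w.under (𝓞 ↥(maximalRealSubfield F))))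
             (IsCMField.complexConj_ne_one F) hJ hw (UnitaryGroup.isUnit_placeForm Jstar hJu w) (HeckeCharacter.uniformizer F w) 2 :
           ↥(finAdelic ↥(maximalRealSubfield F) F (IsCMField.complexConj F) 2 Jstar)) :
           ↥(finAdelic ↥(maximalRealSubfield F) F (IsCMField.complexConj F) 2 Jstar) ⧸
             (Kc.1.1 : Subgroup ↥(finAdelic ↥(maximalRealSubfield F) F (IsCMField.complexConj F) 2 Jstar))) →
       ↥(finAdelic ↥(maximalRealSubfield F) F (IsCMField.complexConj F) 2 Jstar))
    (_hrc₂ : ∀ β, ((rc₂ β : ↥(finAdelic ↥(maximalRealSubfield F) F (IsCMField.complexConj F) 2 Jstar)) :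
        ↥(finAdelic ↥(maximalRealSubfield F) F (IsCMField.complexConj F) 2 Jstar) ⧸
          (Kc.1.1 : Subgroup ↥(finAdelic ↥(maximalRealSubfield F) F (IsCMField.complexConj F) 2 Jstar))) = β.1)
    (hrcN₂ : ∀ β, C5.HeckeLE (rc₂ β) N' Kc)
    (x' : AlgPoints (S.M.obj N') (AlgebraicClosure (w.adicCompletion F))),
    ∃ Hβ : (orbit (Kc.1.1 : Subgroup ↥(finAdelic ↥(maximalRealSubfield F) F (IsCMField.complexConj F) 2 Jstar))
         ((UnitaryGroup.heckeElementAt ↥(maximalRealSubfield F) F (IsCMField.complexConj F) 2 Jstar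
             (⟨w, rfl⟩ : UnitaryGroup.PlacesOver F (w.under (𝓞 ↥(maximalRealSubfield F))))
             (IsCMField.complexConj_ne_one F) hJ hw (UnitaryGroup.isUnit_placeForm Jstar hJu w) (HeckeCharacter.uniformizer F w) 1 :
           ↥(finAdelic ↥(maximalRealSubfield F) F (IsCMField.complexConj F) 2 Jstar)) :
           ↥(finAdelic ↥(maximalRealSubfield F) F (IsCMField.complexConj F) 2 Jstar) ⧸
             (Kc.1.1 : Subgroup ↥(finAdelic ↥(maximalRealSubfield F) F (IsCMField.complexConj F) 2 Jstar)))) →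
        Subgroup ((fibreEOf S Kc w e' univ (AlgPoints.map (S.M.map (homOfLE hN'Kc)) x')).Points (AlgebraicClosure (w.adicCompletion F))),
      -- the lines: `H_β` runs BIJECTIVELY through the `𝒪_F`-stable order-`q` subgroups of `A_y[𝔭_{c•w}](Ω)`
      Function.Injective Hβ ∧
      (∀ β, Nat.card ↥(Hβ β) = pChar ^ fDeg ∧ (∀ P ∈ Hβ β, IsIdealTorsionE S Kc w e' univ act (AlgPoints.map (S.M.map (homOfLE hN'Kc)) x')
          ((IsCMField.complexConj F) • w).asIdeal P) ∧
        ∀ (a : 𝓞 F), ∀ P ∈ Hβ β, (AlgPoints.map (actEOf S Kc w e' univ act a (AlgPoints.map (S.M.map (homOfLE hN'Kc)) x')).hom.hom.hom P :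
          (fibreEOf S Kc w e' univ (AlgPoints.map (S.M.map (homOfLE hN'Kc)) x')).Points (AlgebraicClosure (w.adicCompletion F))) ∈ Hβ β) ∧
      (∀ H : Subgroup ((fibreEOf S Kc w e' univ (AlgPoints.map (S.M.map (homOfLE hN'Kc)) x')).Points (AlgebraicClosure (w.adicCompletion F))),
        Nat.card ↥H = pChar ^ fDeg → (∀ P ∈ H, IsIdealTorsionE S Kc w e' univ act (AlgPoints.map (S.M.map (homOfLE hN'Kc)) x')
          ((IsCMField.complexConj F) • w).asIdeal P) →
        (∀ (a : 𝓞 F), ∀ P ∈ H, (AlgPoints.map (actEOf S Kc w e' univ act a (AlgPoints.map (S.M.map (homOfLE hN'Kc)) x')).hom.hom.hom P :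
          (fibreEOf S Kc w e' univ (AlgPoints.map (S.M.map (homOfLE hN'Kc)) x')).Points (AlgebraicClosure (w.adicCompletion F))) ∈ H) → ∃ β, Hβ β = H) ∧
      -- the `t₁`-translates are the roof neighbours through kernels meeting the `𝔭_{c•w}`-torsion in `H_β`
      (∀ β, ∃ Kβ : Subgroup ((fibreEOf S Kc w e' univ (AlgPoints.map (S.M.map (homOfLE hN'Kc)) x')).Points (AlgebraicClosure (w.adicCompletion F))),
        (∀ P, P ∈ Hβ β ↔ P ∈ Kβ ∧ IsIdealTorsionE S Kc w e' univ act (AlgPoints.map (S.M.map (homOfLE hN'Kc)) x')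
            ((IsCMField.complexConj F) • w).asIdeal P) ∧
        RoofE S Kc w e' univ act dual pol lvl pChar w.asIdeal (AlgPoints.map (S.M.map (homOfLE hN'Kc)) x')
          (AlgPoints.map (recordHeckeTranslateGS S hU7ₛ (rc₁ β) N' Kc (hrcN₁ β)) x') Kβ) ∧
      -- the `t₂`-translate is the roof neighbour through the whole `𝔭_{c•w}`-torsion (the central translate `⟨ϖ⟩`)
      (∀ β₂, ∃ K₂ : Subgroup ((fibreEOf S Kc w e' univ (AlgPoints.map (S.M.map (homOfLE hN'Kc)) x')).Points (AlgebraicClosure (w.adicCompletion F))),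
        (∀ P, P ∈ K₂ ↔ IsIdealTorsionE S Kc w e' univ act (AlgPoints.map (S.M.map (homOfLE hN'Kc)) x')
            ((IsCMField.complexConj F) • w).asIdeal P) ∧
        RoofE S Kc w e' univ act dual pol lvl pChar w.asIdeal (AlgPoints.map (S.M.map (homOfLE hN'Kc)) x')
          (AlgPoints.map (recordHeckeTranslateGS S hU7ₛ (rc₂ β₂) N' Kc (hrcN₂ β₂)) x') K₂)

/-! ### §2 The two letters keyed by an E-witness (what the E-line exports tomorrow; hypotheses of the by-value laws today) -/

/-- **LETTER `EHeckeAt S hU7ₛ hJ hJu Kc w hw E pChar fDeg` — THE HECKE ROOFS OF THE E-WITNESS AT THE SPLIT PLACE `w`**: the spine՚s (U4) reading «both Hecke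
operators at `w` act on the E-tuple by the isogeny roofs through the `𝒪_F`-stable order-`p^f` subgroups of the `𝔭_{c•w}`-torsion» (`HeckeRoofsE` on
`(E.P.A, E.ρ, E.P.D, E.P.pol, E.P.level)`), for the residue characteristic `pChar` and degree `fDeg` the spread will carry.  The HYPOTHESIS of the by-value organ
`heckeRoofsΩ_of_gen_iso` (§3) ∕ `stub_HECKE` (leaf ED. 2); an OBLIGATION of the E-export (door (E): the moduli interpretation of `u ∘ T_t` on `X`, [Liu2021] Lemma C.18).
NOT asserted. [cite: Liu2021, Lemma C.18 p. 115, Prop. D.8 p. 135] [cite: HarrisTaylorAMS2001, §III.4, pp. 108–110] [cite: Kottwitz1992, §5 pp. 389–391] -/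
def EHeckeAt {F : Type} [Field F] [NumberField F] [IsCMField F] {ι₁ : F →+* ℂ} {Jstar : Matrix (Fin 2) (Fin 2) F}
    {K₀ : C5.OpenCompactSubgroup ↥(finAdelic ↥(maximalRealSubfield F) F (IsCMField.complexConj F) 2 Jstar)}
    (S : RecordSystemGS F Jstar ι₁ K₀) (hU7ₛ : S.HeckeTranslateDefinedOver)
    (hJ : (Jstar.map (IsCMField.complexConj F))ᵀ = Jstar) (hJu : IsUnit Jstar)
    {Fi : Type} [Field Fi] [NumberField Fi] [Algebra F Fi] (Kc : C5.SmallLevel K₀)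
    (w : HeightOneSpectrum (𝓞 F)) (hw : (IsCMField.complexConj F) • w ≠ w)
    {τE : Fi →+* ℂ} {Φ : Set (F →+* ℂ)} (E : PELWitnessE F ι₁ Jstar K₀ S Kc Fi τE Φ) (pChar fDeg : ℕ) : Prop :=
  HeckeRoofsE S hU7ₛ hJ hJu Kc w hw E.P.A E.ρ E.P.D E.P.pol E.P.level pChar fDeg

set_option maxHeartbeats 400000 in
/-- **LETTER `ETwistAt S Kc w e E pChar fDeg` — THE TWIST IDEALS, THEIR NORMS, THEIR FROBENIUS SHAPE AND THE SERRE COVERS OF THE E-WITNESS between the sheets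
`e′` and `e′ ∘ γ`**: the rows (a) `(n_γ) = 𝔞_γ 𝔞̄_γ`, (b) `𝔞_γ ⊥ N`, (c) `𝔞_γ ≠ 0`, (FROB-𝔞) `𝔭_w ∣ 𝔞_{γ_σ}` and (FROB-n) `n_{γ_σ} = p^f` for an arithmetic Frobenius `σ`
at `w` reading `γ_σ` on the datum sheet `e` (`σ ∘ e = e ∘ γ_σ`), and the covers `CoverE … e′ … (e′ ∘ γ) 𝔞_γ n_γ y` — the rows of the P-line՚s `PELTwistLawAt T`
VERBATIM with `T.E.N ↦ E.N`, `T.pChar ^ T.fDeg ↦ pChar ^ fDeg`, `CoverΩ … T.univ … ↦ CoverE … E.P.A …`.  The HYPOTHESIS of `coverΩ_of_gen_iso` (§3) ∕ `stub_TWIST`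
(leaf ED. 2); an OBLIGATION of the E-export (Shimura–Taniyama reciprocity on the CM sheets + the adapted-frame arithmetic of `(F, w, Φ)`: `𝔞 := ∏_{τ ∈ Φ_w} ker (residue ∘ τ|_{𝒪_F})`,
`𝔞 𝔞̄ = (p)^{f_w}`, ★ p847313 §2).  NOT asserted. [cite: Shimura1998, §13.1, Theorem 1; §18.6] [cite: Conrad2004GrossZagier, §7, Thm. 7.6]
[cite: RapoportSmithlingZhang2020Diagonal, §3.2 p. 11, §4.3 p. 20] -/
def ETwistAt {F : Type} [Field F] [NumberField F] [IsCMField F] {ι₁ : F →+* ℂ} {Jstar : Matrix (Fin 2) (Fin 2) F}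
    {K₀ : C5.OpenCompactSubgroup ↥(finAdelic ↥(maximalRealSubfield F) F (IsCMField.complexConj F) 2 Jstar)}
    (S : RecordSystemGS F Jstar ι₁ K₀) {Fi : Type} [Field Fi] [NumberField Fi] [Algebra F Fi] (Kc : C5.SmallLevel K₀)
    (w : HeightOneSpectrum (𝓞 F)) (e : Fi →ₐ[F] AlgebraicClosure (w.adicCompletion F))
    {τE : Fi →+* ℂ} {Φ : Set (F →+* ℂ)} (E : PELWitnessE F ι₁ Jstar K₀ S Kc Fi τE Φ) (pChar fDeg : ℕ) : Prop :=
  ∃ (twistIdeal : (Fi ≃ₐ[F] Fi) → Ideal (𝓞 F)) (twistNorm : (Fi ≃ₐ[F] Fi) → ℕ),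
    (∀ γ : Fi ≃ₐ[F] Fi, Ideal.span {((twistNorm γ : ℕ) : 𝓞 F)} = twistIdeal γ * (IsCMField.complexConj F) • twistIdeal γ) ∧
    (∀ γ : Fi ≃ₐ[F] Fi, twistIdeal γ ⊔ Ideal.span {((E.N : ℕ) : 𝓞 F)} = ⊤) ∧
    (∀ γ : Fi ≃ₐ[F] Fi, twistIdeal γ ≠ ⊥) ∧
    (∀ (σ : Field.absoluteGaloisGroup (w.adicCompletion F)), IsAbsArithFrob σ → ∀ γ : Fi ≃ₐ[F] Fi,
      ((AlgEquiv.restrictScalars F (Field.absoluteGaloisGroup.toAlgEquiv (w.adicCompletion F) σ) :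
          AlgebraicClosure (w.adicCompletion F) ≃ₐ[F] AlgebraicClosure (w.adicCompletion F)) :
          AlgebraicClosure (w.adicCompletion F) →ₐ[F] AlgebraicClosure (w.adicCompletion F)).comp e = e.comp (γ : Fi →ₐ[F] Fi) →
      w.asIdeal ∣ twistIdeal γ) ∧
    (∀ (σ : Field.absoluteGaloisGroup (w.adicCompletion F)), IsAbsArithFrob σ → ∀ γ : Fi ≃ₐ[F] Fi,
      ((AlgEquiv.restrictScalars F (Field.absoluteGaloisGroup.toAlgEquiv (w.adicCompletion F) σ) :
          AlgebraicClosure (w.adicCompletion F) ≃ₐ[F] AlgebraicClosure (w.adicCompletion F)) :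
          AlgebraicClosure (w.adicCompletion F) →ₐ[F] AlgebraicClosure (w.adicCompletion F)).comp e = e.comp (γ : Fi →ₐ[F] Fi) →
      twistNorm γ = pChar ^ fDeg) ∧
    ∀ (e' : Fi →ₐ[F] AlgebraicClosure (w.adicCompletion F)) (γ : Fi ≃ₐ[F] Fi)
      (y : AlgPoints (S.M.obj Kc) (AlgebraicClosure (w.adicCompletion F))),
      CoverE S Kc w e' E.P.A E.ρ E.P.D E.P.pol E.P.level (e'.comp (γ : Fi →ₐ[F] Fi)) (twistIdeal γ) (twistNorm γ) y

end Summit.HodgeConjecture.HodgeConjecture.Cruxes.HLiu418.F0P6aEReadings
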